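import Summits.CriticalPhenomena.PercolationContinuityZ3.Theorems.Transplant.SkelPhiFaceRunNbS
import Summits.CriticalPhenomena.PercolationContinuityZ3.Theorems.Transplant.SkelPhiConcScheduleN
import HarnessLib

/-!
# N2 (frames-only node `SamePDropOfSkeletonFrm₁`, OPEN), (C) column: THE HABITAT RADII AT A CHOSEN EDGE OF THE SCHEME OF RECORD —
# `Skelφ.reach_radii_concSG₂NbS` (twin of `reach_radii_concSG₂NS`, SkelPhiNegRealisedS, over hp-8 g40's small-box scheme `cellGeomSG₂bS`)

At a chosen, valid probe `(h, e)` of `⟨cellGeomSG₂bS G ψ P t (concRadii2N P.toPCells2 gap gap' E₀ L' off) b₀, q, δc⟩` with `ψ t = 0`, the anchors `α := aOf₁O`,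
`β := aOf₂O` are REALISED (`realised_of_choice_SG₂bS`, hp-8 g40), so with `E := Erad (nQ α (tgt e))`: `rQ α (tgt e) = E` (the column slot inactive:
`off x ≤ c·‖x‖₁ + 1`, `c ≤ gap`, `20·rmax ≤ gap`, `‖tgt e‖₁ ≤ nQ α (tgt e)`), `ρ β (tgt e) du ℓ = E − 2`, `rM β (tgt e + du) = Frad (nQ α (tgt e) + 1) − L'`,
`nQ α (tgt e) = nS α e.1 + 1`, and `‖tgt e‖₁ ≤ nQ α (tgt e)`. These are the per-probe radius rows `hDQ/hDρ'/hρM/hRD` of the (C) residue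
(`reachOblAtHNF_frmQ3_fst/_snd`, SkelFrm1ReachRowsQ) at the window radius `R := E − 3`, INCLUDING the root anchor `β = 0` (which the anchor-arithmetic
lemma `Prm.schedN_ρ_succ_le_rM` of SkelPhiConcScheduleNRho does not reach).
builds on p205010 (kernel theorem, internal audit signed; external expert review pending) — nothing in this file uses p205010; nothing here is a claim
about the open node `SamePDropOfSkeletonFrm₁`.
Lane `prim-bschramm`, seat `prim-bschramm-p5` (gen 16; (C) lineage); helper file (`--supports stmt-CriticalPhenomena-4575 --as helper`).
[cite: KozmaNitzan2024, §4 pp. 25–27, 30–31 (Q_v, M_v, H^j_{v,x}: the windows grow with the level)]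
-/

noncomputable section

open scoped Classical

namespace Summit.CriticalPhenomena.PercolationContinuityZ3.Theorems.Transplant

namespace Skelφ

open Literature.Probability.Percolation Literature.Probability.LatticeModels SimpleGraph KNCells KNLevels GadgetSystem Contour
open BoxProdZ2 (Realised ConcRadiiG nQ nS Erad Frad)
open Skel (nQ_tgt_eq_nS_src_succO)

variable {V : Type} [DecidableEq V] {G : SimpleGraph V} [G.LocallyFinite] {ψ : V → Site 2}

section ReachRadii

variable {P : PCells2S} {t : V} {gap gap' : ℕ → ℕ} {E₀ L' : ℕ} {off : Site 2 → ℕ} {b₀ : Fin 2 → ℕ} {q : unitInterval} {δc : ℝ}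

/-- **The (C) habitat radii at a chosen edge of the N2 scheme of record** over `Λ = concRadii2N P.toPCells2 gap gap' E₀ L' off`, small boxes `b₀`
(`20·rmax ≤ gap`, slot `off x ≤ c·‖x‖₁ + 1` with `c ≤ gap`, `1 ≤ E₀`, root footprint `0`): with `E := Erad (nQ α x)`, `rQ α x = E`, `rB α v δ = E`,
`ρ β x du ℓ = E − 2`, `rE β x du = Frad (nQ α x + 1) − 1`, `rM β (x+du) = Frad (nQ α x + 1) − L'`, `nQ α x = nS α v + 1`, `‖x‖₁ ≤ nQ α x`. [this work] -/
theorem reach_radii_concSG₂NbS [Countable V] (hgap : ∀ n, 20 * P.rmax ≤ gap n) {c : ℕ} (hgapc : ∀ n, c ≤ gap n)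
    (hoff : ∀ x : Site 2, off x ≤ c * ((x 0).natAbs + (x 1).natAbs) + 1) (hE₀ : 1 ≤ E₀) (hψ : ψ t = 0)
    {h : ProbeHistory V} {e : Site 2 × MDir}
    (hc : ((⟨cellGeomSG₂bS G ψ P t (concRadii2N P.toPCells2 gap gap' E₀ L' off) b₀, q, δc⟩ : KSchA V ℕ).astOf₂O G h).st.ochoice KSchA.qNE = some e)
    (hV : (⟨cellGeomSG₂bS G ψ P t (concRadii2N P.toPCells2 gap gap' E₀ L' off) b₀, q, δc⟩ : KSchA V ℕ).Valid₂O G h e) {du : MDir}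
    (hdu : du ∈ (⟨cellGeomSG₂bS G ψ P t (concRadii2N P.toPCells2 gap gap' E₀ L' off) b₀, q, δc⟩ : KSchA V ℕ).onwardO G h (tgt e)) :
    let α := (⟨cellGeomSG₂bS G ψ P t (concRadii2N P.toPCells2 gap gap' E₀ L' off) b₀, q, δc⟩ : KSchA V ℕ).aOf₁O G h e
    let β := (⟨cellGeomSG₂bS G ψ P t (concRadii2N P.toPCells2 gap gap' E₀ L' off) b₀, q, δc⟩ : KSchA V ℕ).aOf₂O G h e
    (concRadii2N P.toPCells2 gap gap' E₀ L' off).rQ α (tgt e) = Erad gap gap' E₀ (nQ α (tgt e)) ∧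
    (concRadii2N P.toPCells2 gap gap' E₀ L' off).rB α e.1 e.2 = Erad gap gap' E₀ (nQ α (tgt e)) ∧
    (∀ ℓ, (concRadii2N P.toPCells2 gap gap' E₀ L' off).ρ β (tgt e) du ℓ = Erad gap gap' E₀ (nQ α (tgt e)) - 2) ∧
    (concRadii2N P.toPCells2 gap gap' E₀ L' off).rE β (tgt e) du = Frad gap gap' E₀ (nQ α (tgt e) + 1) - 1 ∧
    (concRadii2N P.toPCells2 gap gap' E₀ L' off).rM β (tgt e + stepVec du) = Frad gap gap' E₀ (nQ α (tgt e) + 1) - L' ∧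
    nQ α (tgt e) = nS α e.1 + 1 ∧
    ((tgt e) 0).natAbs + ((tgt e) 1).natAbs ≤ nQ α (tgt e) := by
  intro α β
  have hreal : Realised α β (tgt e) := realised_of_choice_SG₂bS h hc
  have hy : tgt e + stepVec du ≠ 0 := tgt_add_stepVec_ne_zero₂bS hψ hV hdu
  have hxn := l1_tgt_le_nQ₂bS h hc
  obtain ⟨h1, h2, h3⟩ := hreal.sched_hyps hy
  refine ⟨?_, rfl, fun ℓ => ?_, ?_, ?_, ?_, hxn⟩
  · exact concRadii2N_rQ_eq_of_norm_le P.toPCells2 gap' E₀ L' off hgap hgapc hE₀ hxn (hoff _)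
  · rw [concRadii2N_ρ_eq P.toPCells2 gap gap' E₀ L' off h1 h2 ℓ, hreal.nS_eq]
  · rw [concRadii2N_rE_eq P.toPCells2 gap gap' E₀ L' off h3, hreal.nS_eq]
  · rw [concRadii2N_rM, hreal.nQ_add_stepVec hy]
  · exact nQ_tgt_eq_nS_src_succO (cellGeomSG₂bS_anchor' G ψ P t _ b₀ q δc) (cellGeomSG₂bS_a₀' G ψ P t _ b₀ q δc) h hc

/-- **THE FOUR RADIUS ROWS OF THE (C) RESIDUE AT THE WINDOW RADIUS `R := E − 3`** (`E := Erad (nQ α (tgt e))`), at a chosen valid probe: `R + 1 ≤ rQ α (tgt e)`,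
`R + 1 ≤ ρ β (tgt e) du ℓ`, `ρ β (tgt e) du ℓ + 1 ≤ rM β (tgt e + stepVec du)` (from `L' ≤ gap _`, `gap' = 0`), and the linear depth `E₀ + c·‖tgt e‖₁ ≤ E`.
[cite: KozmaNitzan2024, §4 pp. 25–27] -/
theorem reach_radius_rows_concSG₂NbS [Countable V] (hgap : ∀ n, 20 * P.rmax ≤ gap n) {c : ℕ} (hgapc : ∀ n, c ≤ gap n) (hL : ∀ n, L' ≤ gap n)
    (hoff : ∀ x : Site 2, off x ≤ c * ((x 0).natAbs + (x 1).natAbs) + 1) (hE₀ : 3 ≤ E₀) (hψ : ψ t = 0)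
    {h : ProbeHistory V} {e : Site 2 × MDir}
    (hc : ((⟨cellGeomSG₂bS G ψ P t (concRadii2N P.toPCells2 gap (fun _ => 0) E₀ L' off) b₀, q, δc⟩ : KSchA V ℕ).astOf₂O G h).st.ochoice KSchA.qNE = some e)
    (hV : (⟨cellGeomSG₂bS G ψ P t (concRadii2N P.toPCells2 gap (fun _ => 0) E₀ L' off) b₀, q, δc⟩ : KSchA V ℕ).Valid₂O G h e) {du : MDir}
    (hdu : du ∈ (⟨cellGeomSG₂bS G ψ P t (concRadii2N P.toPCells2 gap (fun _ => 0) E₀ L' off) b₀, q, δc⟩ : KSchA V ℕ).onwardO G h (tgt e)) :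
    (Erad gap (fun _ => 0) E₀ (nQ ((⟨cellGeomSG₂bS G ψ P t (concRadii2N P.toPCells2 gap (fun _ => 0) E₀ L' off) b₀, q, δc⟩ : KSchA V ℕ).aOf₁O G h e) (tgt e)) - 3) + 1 ≤ (concRadii2N P.toPCells2 gap (fun _ => 0) E₀ L' off).rQ ((⟨cellGeomSG₂bS G ψ P t (concRadii2N P.toPCells2 gap (fun _ => 0) E₀ L' off) b₀, q, δc⟩ : KSchA V ℕ).aOf₁O G h e) (tgt e) ∧
    (∀ ℓ, (Erad gap (fun _ => 0) E₀ (nQ ((⟨cellGeomSG₂bS G ψ P t (concRadii2N P.toPCells2 gap (fun _ => 0) E₀ L' off) b₀, q, δc⟩ : KSchA V ℕ).aOf₁O G h e) (tgt e)) - 3) + 1 ≤ (concRadii2N P.toPCells2 gap (fun _ => 0) E₀ L' off).ρ ((⟨cellGeomSG₂bS G ψ P t (concRadii2N P.toPCells2 gap (fun _ => 0) E₀ L' off) b₀, q, δc⟩ : KSchA V ℕ).aOf₂O G h e) (tgt e) du ℓ) ∧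
    (∀ ℓ, (concRadii2N P.toPCells2 gap (fun _ => 0) E₀ L' off).ρ ((⟨cellGeomSG₂bS G ψ P t (concRadii2N P.toPCells2 gap (fun _ => 0) E₀ L' off) b₀, q, δc⟩ : KSchA V ℕ).aOf₂O G h e) (tgt e) du ℓ + 1 ≤
      (concRadii2N P.toPCells2 gap (fun _ => 0) E₀ L' off).rM ((⟨cellGeomSG₂bS G ψ P t (concRadii2N P.toPCells2 gap (fun _ => 0) E₀ L' off) b₀, q, δc⟩ : KSchA V ℕ).aOf₂O G h e) (tgt e + stepVec du)) ∧
    E₀ + c * (((tgt e) 0).natAbs + ((tgt e) 1).natAbs) ≤ Erad gap (fun _ => 0) E₀ (nQ ((⟨cellGeomSG₂bS G ψ P t (concRadii2N P.toPCells2 gap (fun _ => 0) E₀ L' off) b₀, q, δc⟩ : KSchA V ℕ).aOf₁O G h e) (tgt e)) := by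
  obtain ⟨hQ, -, hρ, -, hM, -, hxn⟩ := reach_radii_concSG₂NbS (b₀ := b₀) (q := q) (δc := δc) (gap' := fun _ => 0) (L' := L') hgap hgapc hoff (by omega) hψ hc hV hdu
  set E := Erad gap (fun _ => 0) E₀ (nQ ((⟨cellGeomSG₂bS G ψ P t (concRadii2N P.toPCells2 gap (fun _ => 0) E₀ L' off) b₀, q, δc⟩ : KSchA V ℕ).aOf₁O G h e) (tgt e)) with hEdef
  have hEE₀ : E₀ ≤ E := Skel.E₀_le_Erad gap _ E₀ _
  have hF : Frad gap (fun _ => 0) E₀ (nQ ((⟨cellGeomSG₂bS G ψ P t (concRadii2N P.toPCells2 gap (fun _ => 0) E₀ L' off) b₀, q, δc⟩ : KSchA V ℕ).aOf₁O G h e) (tgt e) + 1) = E + gap E := BoxProdZ2.Frad_succ gap _ E₀ _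
  have hLE := hL E
  refine ⟨?_, fun ℓ => ?_, fun ℓ => ?_, ?_⟩
  · rw [hQ]; omega
  · rw [hρ ℓ]; omega
  · rw [hρ ℓ, hM, hF]; omega
  · exact le_trans (Nat.add_le_add_left (Nat.mul_le_mul_left c hxn) E₀) (Erad_linear (fun _ => 0) E₀ hgapc _)

end ReachRadii

end Skelφ

end Summit.CriticalPhenomena.PercolationContinuityZ3.Theorems.Transplant

end
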